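import Literature.Computability.AlgebraicComplexity.TensorSemiringSpectrum
import Literature.Computability.AlgebraicComplexity.SchoenhageTauDischarge
import HarnessLib

/-!
# Degenerations (approximate restrictions over `K[ε]`) and the asymptotic spectrum: universal spectral points are monotone under degeneration

Topic `Literature/Computability/AlgebraicComplexity`. Coordinate 3-tensors `ι → κ → μ → K` as in
`MatrixMultiplicationExponent.lean` / `AsymptoticSpectrum.lean`; approximate (border) notions over
`K[ε] = K[X]` as in `SchoenhageTau.lean` (`IsApproxDecomposition`, Bläser 2013, Def. 6.1).

## Content

* `IsApproxRestriction h s t A B C` — **degeneration of order `h`**: polynomial matrices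
  `A(ε), B(ε), C(ε)` with `(A(ε) ⊗ B(ε) ⊗ C(ε)) s = ε^h t + O(ε^{h+1})`, coefficientwise
  (Bürgisser–Clausen–Shokrollahi 1997, (15.19) "`t` is a degeneration of order `q` of `t'`,
  `t ⊴_q t'`"; Strassen 1987/1988; the `K[ε]`-form of Bläser 2013, Def. 6.1, which is the special
  case `s = ⟨r⟩`, `IsApproxDecomposition.isApproxRestriction_unitTensor`).
  `AlgDegeneratesTo s t` — `t ⊴ s` for some order (the ALGEBRAIC degeneration over `K[ε]`; the
  topological notion over `ℂ` is `TensorDegeneratesTo` of `QuantumFunctionals.lean`).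
* Calculus: restrictions are degenerations of order `0`; composition with restrictions on either
  side; reindexing; Kronecker products (orders add, BCS (15.25)) and Kronecker powers.
* `IsApproxRestriction.restrictsTo_kronecker_coeffTensor` — **a degeneration of order `h` is a
  restriction of `s ⊗ M_h`**, `M_h ∈ K^{(h+1)×(h+1)×(h+1)}` the trilinear "coefficient of `ε^h`" tensor
  `(M_h)_{ijl} = [i+j+l = h]`, of rank `≤ (h+1)²` (`tensorRank_coeffTensor_le`) — the mechanism of
  Bini's bound `R(t) ≤ c_h R_h(t)` (Bläser 2013, Lemma 6.4; BCS (15.26)).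
* `IsUniversalSpectralPoint.mono_of_algDegeneratesTo` — **every universal spectral point is
  monotone under degeneration**: `t ⊴ s ⟹ F(t) ≤ F(s)` (Strassen 1988, §3; Christandl–Vrana–Zuiddam
  2023, §1.2: spectral points may equivalently be required to be monotone under degeneration).
  Proof: `t^{⊗N} ⊴_{Nh} s^{⊗N}`, so `F(t)^N ≤ F(s)^N R(M_{Nh}) ≤ F(s)^N (Nh+1)²`, and `N → ∞`
  (`le_of_forall_pow_le_polynomial_mul_pow`).
* `IsUniversalSpectralPoint.le_of_algBorderRank_le` — `bR(t) ≤ r ⟹ F(t) ≤ r`.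

## References

* P. Bürgisser, M. Clausen, M. A. Shokrollahi, *Algebraic Complexity Theory*, Springer 1997, §15.4,
  (15.19)–(15.27). [BurgisserClausenShokrollahi1997]
* V. Strassen, *The asymptotic spectrum of tensors*, J. reine angew. Math. 384 (1988) 102–152, §3.
  [Strassen1988]
* M. Christandl, P. Vrana, J. Zuiddam, *Universal points in the asymptotic spectrum of tensors*,
  J. Amer. Math. Soc. 36 (2023), §1.2. [ChristandlVranaZuiddam2023]
* M. Bläser, *Fast Matrix Multiplication*, Theory of Computing Graduate Surveys 5 (2013), Def. 6.1,
  Lemma 6.4. [Blaser2013]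
-/

noncomputable section

open scoped BigOperators Polynomial
open Polynomial

namespace Literature.Computability.AlgebraicComplexity

universe u

/-! ## A product of three finite sums -/

section SumHelper

/-- `(∑ f)(∑ g)(∑ k) w = ∑_{a,b,c} f_a g_b k_c w`, with the binders in this order. [folklore] -/
theorem sum_mul_sum_mul_sum_mul {R : Type*} [CommSemiring R] {α β γ : Type*} [Fintype α] [Fintype β]
    [Fintype γ] (f : α → R) (g : β → R) (k : γ → R) (w : R) :
    (∑ a, f a) * (∑ b, g b) * (∑ c, k c) * w = ∑ a, ∑ b, ∑ c, f a * g b * k c * w := by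
  rw [Finset.sum_mul_sum, Finset.sum_mul, Finset.sum_mul]
  refine Finset.sum_congr rfl fun a _ => ?_
  rw [Finset.sum_mul, Finset.sum_mul]
  refine Finset.sum_congr rfl fun b _ => ?_
  rw [Finset.mul_sum, Finset.sum_mul]

end SumHelper

/-! ## Degenerations: approximate restrictions over `K[ε]` -/

section Defs

variable {K : Type u} [CommSemiring K]
variable {ι κ μ ι' κ' μ' ι'' κ'' μ'' : Type*}

/-- **Degeneration of order `h`** (`t ⊴_h s`; BCS (15.19), in coordinates over `K[ε] = K[X]`):
polynomial matrices `A(ε) ∈ K[ε]^{ι'×ι}`, `B(ε)`, `C(ε)` such that every entry of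
`(A(ε) ⊗ B(ε) ⊗ C(ε)) s`, i.e. the polynomial `∑_{a,b,c} A_{a'a} B_{b'b} C_{c'c} s_{abc}`, has vanishing
coefficients below degree `h` and coefficient `t_{a'b'c'}` in degree `h`.
[cite: BurgisserClausenShokrollahi1997, (15.19)] -/
def IsApproxRestriction [Fintype ι] [Fintype κ] [Fintype μ] (h : ℕ) (s : ι → κ → μ → K)
    (t : ι' → κ' → μ' → K) (A : ι' → ι → K[X]) (B : κ' → κ → K[X]) (C : μ' → μ → K[X]) : Prop :=
  ∀ a' b' c', ∀ j ≤ h,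
    (∑ a, ∑ b, ∑ c, A a' a * B b' b * C c' c * Polynomial.C (s a b c)).coeff j =
      if j = h then t a' b' c' else 0

/-- **`t` is a degeneration of `s`** (`t ⊴ s`): a degeneration of some order exists
(BCS (15.19); Strassen 1988, §3). [cite: BurgisserClausenShokrollahi1997, (15.19)] -/
def AlgDegeneratesTo [Fintype ι] [Fintype κ] [Fintype μ] (s : ι → κ → μ → K)
    (t : ι' → κ' → μ' → K) : Prop :=
  ∃ (h : ℕ) (A : ι' → ι → K[X]) (B : κ' → κ → K[X]) (C : μ' → μ → K[X]),
    IsApproxRestriction h s t A B C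

/-- A restriction is a degeneration of order `0` (constant matrices; BCS (15.20):
"`t ≤ t'` implies `t ⊴_0 t'`"). [cite: BurgisserClausenShokrollahi1997, (15.20)] -/
theorem isApproxRestriction_zero_of_eq_sum [Fintype ι] [Fintype κ] [Fintype μ] {s : ι → κ → μ → K}
    {t : ι' → κ' → μ' → K} {A : ι' → ι → K} {B : κ' → κ → K} {C : μ' → μ → K}
    (hs : ∀ a' b' c', t a' b' c' = ∑ a, ∑ b, ∑ c, A a' a * B b' b * C c' c * s a b c) :
    IsApproxRestriction 0 s t (fun a' a => Polynomial.C (A a' a)) (fun b' b => Polynomial.C (B b' b))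
      (fun c' c => Polynomial.C (C c' c)) := by
  intro a' b' c' j hj
  obtain rfl : j = 0 := Nat.le_zero.1 hj
  have e : (∑ a, ∑ b, ∑ c, Polynomial.C (A a' a) * Polynomial.C (B b' b) * Polynomial.C (C c' c) *
      Polynomial.C (s a b c)) = Polynomial.C (∑ a, ∑ b, ∑ c, A a' a * B b' b * C c' c * s a b c) := by
    simp only [map_sum, Polynomial.C_mul]
  rw [e, Polynomial.coeff_C_zero, if_pos rfl, hs]

/-- `t ≤ s ⟹ t ⊴ s`. [cite: BurgisserClausenShokrollahi1997, (15.20)] -/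
theorem TensorRestrictsTo.algDegeneratesTo [Fintype ι] [Fintype κ] [Fintype μ] {s : ι → κ → μ → K}
    {t : ι' → κ' → μ' → K} (h : TensorRestrictsTo s t) : AlgDegeneratesTo s t := by
  obtain ⟨A, B, C, hs⟩ := h
  exact ⟨0, _, _, _, isApproxRestriction_zero_of_eq_sum hs⟩

/-- **An approximate decomposition is a degeneration of the unit tensor**: `R_h(t) ≤ r` via
`(u, v, w)` means `t ⊴_h ⟨r⟩` with the matrices whose columns are the `u_ρ, v_ρ, w_ρ`
(Bläser 2013, Def. 6.1 is BCS (15.19) for `s = ⟨r⟩`). [cite: Blaser2013, Def. 6.1] -/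
theorem IsApproxDecomposition.isApproxRestriction_unitTensor {h : ℕ} {t : ι' → κ' → μ' → K} {r : ℕ}
    {u : Fin r → ι' → K[X]} {v : Fin r → κ' → K[X]} {w : Fin r → μ' → K[X]}
    (huvw : IsApproxDecomposition h t u v w) :
    IsApproxRestriction h (unitTensor K r) t (fun a i => u i a) (fun b i => v i b) (fun c i => w i c) := by
  intro a' b' c' j hj
  have hsum : (∑ i, ∑ i', ∑ i'', u i a' * v i' b' * w i'' c' * Polynomial.C (unitTensor K r i i' i'')) =
      ∑ i, u i a' * v i b' * w i c' := by
    refine Finset.sum_congr rfl fun i _ => ?_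
    rw [Finset.sum_eq_single i (fun j _ hj => by simp [Ne.symm hj]) (by simp),
      Finset.sum_eq_single i (fun k _ hk => by simp [Ne.symm hk]) (by simp)]
    simp
  rw [hsum]
  exact huvw a' b' c' j hj

/-- **Composition with a restriction on the source side**: `s ≥ s'` and `t ⊴_h s'` give `t ⊴_h s`
(compose the constant matrices into the polynomial ones; BCS (15.25) with (15.20)).
[cite: BurgisserClausenShokrollahi1997, (15.25)] -/
theorem IsApproxRestriction.comp_eq_sum [Fintype ι] [Fintype κ] [Fintype μ] [Fintype ι'']
    [Fintype κ''] [Fintype μ''] {h : ℕ} {s : ι → κ → μ → K} {s' : ι'' → κ'' → μ'' → K}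
    {t : ι' → κ' → μ' → K} {A₀ : ι'' → ι → K} {B₀ : κ'' → κ → K} {C₀ : μ'' → μ → K}
    (hs : ∀ a' b' c', s' a' b' c' = ∑ a, ∑ b, ∑ c, A₀ a' a * B₀ b' b * C₀ c' c * s a b c)
    {A : ι' → ι'' → K[X]} {B : κ' → κ'' → K[X]} {C : μ' → μ'' → K[X]}
    (hd : IsApproxRestriction h s' t A B C) :
    IsApproxRestriction h s t (fun a' a => ∑ a'', A a' a'' * Polynomial.C (A₀ a'' a))
      (fun b' b => ∑ b'', B b' b'' * Polynomial.C (B₀ b'' b))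
      (fun c' c => ∑ c'', C c' c'' * Polynomial.C (C₀ c'' c)) := by
  intro a' b' c' j hj
  rw [← hd a' b' c' j hj]
  congr 1
  simp only [sum_mul_sum_mul_sum_mul]
  simp only [hs, map_sum, Polynomial.C_mul, Finset.mul_sum]
  -- LHS binders `a b c a'' b'' c''`, RHS binders `a'' b'' c'' a b c`
  rw [sum_comm₃]
  refine Finset.sum_congr rfl fun a'' _ => Finset.sum_congr rfl fun b'' _ =>
    Finset.sum_congr rfl fun c'' _ => Finset.sum_congr rfl fun a _ =>
    Finset.sum_congr rfl fun b _ => Finset.sum_congr rfl fun c _ => ?_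
  ring

/-- `s ≥ s'`, `t ⊴ s'` `⟹` `t ⊴ s`. [cite: BurgisserClausenShokrollahi1997, (15.25)] -/
theorem TensorRestrictsTo.algDegeneratesTo_trans [Fintype ι] [Fintype κ] [Fintype μ] [Fintype ι'']
    [Fintype κ''] [Fintype μ''] {s : ι → κ → μ → K} {s' : ι'' → κ'' → μ'' → K}
    {t : ι' → κ' → μ' → K} (hss' : TensorRestrictsTo s s') (hs't : AlgDegeneratesTo s' t) :
    AlgDegeneratesTo s t := by
  obtain ⟨A₀, B₀, C₀, hs⟩ := hss'
  obtain ⟨h, A, B, C, hd⟩ := hs't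
  exact ⟨h, _, _, _, IsApproxRestriction.comp_eq_sum hs hd⟩

/-- **Composition with a restriction on the target side**: `t ⊴_h s` and `t ≥ t'` give `t' ⊴_h s`
(BCS (15.25) with (15.20)). [cite: BurgisserClausenShokrollahi1997, (15.25)] -/
theorem IsApproxRestriction.eq_sum_comp [Fintype ι] [Fintype κ] [Fintype μ] [Fintype ι']
    [Fintype κ'] [Fintype μ'] {h : ℕ} {s : ι → κ → μ → K} {t : ι' → κ' → μ' → K}
    {t' : ι'' → κ'' → μ'' → K} {A : ι' → ι → K[X]} {B : κ' → κ → K[X]} {C : μ' → μ → K[X]}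
    (hd : IsApproxRestriction h s t A B C) {A₁ : ι'' → ι' → K} {B₁ : κ'' → κ' → K} {C₁ : μ'' → μ' → K}
    (ht : ∀ x y z, t' x y z = ∑ a', ∑ b', ∑ c', A₁ x a' * B₁ y b' * C₁ z c' * t a' b' c') :
    IsApproxRestriction h s t' (fun x a => ∑ a', Polynomial.C (A₁ x a') * A a' a)
      (fun y b => ∑ b', Polynomial.C (B₁ y b') * B b' b)
      (fun z c => ∑ c', Polynomial.C (C₁ z c') * C c' c) := by
  intro x y z j hj
  have hsum : (∑ a, ∑ b, ∑ c, (∑ a', Polynomial.C (A₁ x a') * A a' a) *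
      (∑ b', Polynomial.C (B₁ y b') * B b' b) * (∑ c', Polynomial.C (C₁ z c') * C c' c) *
        Polynomial.C (s a b c)) =
      ∑ a', ∑ b', ∑ c', Polynomial.C (A₁ x a' * B₁ y b' * C₁ z c') *
        ∑ a, ∑ b, ∑ c, A a' a * B b' b * C c' c * Polynomial.C (s a b c) := by
    simp only [sum_mul_sum_mul_sum_mul]
    simp only [Polynomial.C_mul, Finset.mul_sum]
    -- LHS binders `a b c a' b' c'`, RHS binders `a' b' c' a b c`
    rw [sum_comm₃]
    refine Finset.sum_congr rfl fun a' _ => Finset.sum_congr rfl fun b' _ =>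
      Finset.sum_congr rfl fun c' _ => Finset.sum_congr rfl fun a _ =>
      Finset.sum_congr rfl fun b _ => Finset.sum_congr rfl fun c _ => ?_
    ring
  rw [hsum, Polynomial.finsetSum_coeff]
  simp only [Polynomial.finsetSum_coeff, Polynomial.coeff_C_mul, hd _ _ _ j hj]
  split_ifs with hjh
  · rw [ht]
  · simp

/-- `t ⊴ s`, `t ≥ t'` `⟹` `t' ⊴ s`. [cite: BurgisserClausenShokrollahi1997, (15.25)] -/
theorem AlgDegeneratesTo.trans_restrictsTo [Fintype ι] [Fintype κ] [Fintype μ] [Fintype ι']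
    [Fintype κ'] [Fintype μ'] {s : ι → κ → μ → K} {t : ι' → κ' → μ' → K} {t' : ι'' → κ'' → μ'' → K}
    (hst : AlgDegeneratesTo s t) (htt' : TensorRestrictsTo t t') : AlgDegeneratesTo s t' := by
  obtain ⟨h, A, B, C, hd⟩ := hst
  obtain ⟨A₁, B₁, C₁, ht⟩ := htt'
  exact ⟨h, _, _, _, hd.eq_sum_comp ht⟩

/-- **`bR(t) ≤ r ⟹ t ⊴ ⟨r⟩`** (finite index types): the border rank over `K[ε]` is witnessed by a
degeneration of a unit tensor (BCS (15.19)–(15.21): `bR(t) ≤ r ⟺ t ⊴ ⟨r⟩`, one direction).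
[cite: BurgisserClausenShokrollahi1997, (15.19)] -/
theorem algDegeneratesTo_unitTensor_of_algBorderRank_le [Fintype ι'] [Fintype κ'] [Fintype μ']
    [DecidableEq ι'] [DecidableEq κ'] [DecidableEq μ'] (t : ι' → κ' → μ' → K) {r : ℕ}
    (hr : algBorderRank t ≤ r) : AlgDegeneratesTo (unitTensor K r) t := by
  obtain ⟨h, hh⟩ := exists_algBorderRank_eq_approxRank t
  obtain ⟨u, v, w, huvw⟩ := exists_isApproxDecomposition_approxRank h t
  have hle : approxRank h t ≤ r := hh ▸ hr
  exact (tensorRestrictsTo_unitTensor_castLE (K := K) hle).algDegeneratesTo_trans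
    ⟨h, _, _, _, huvw.isApproxRestriction_unitTensor⟩

/-- Reindexing the target along arbitrary index maps keeps a degeneration of order `h`
(precompose the matrices). [cite: BurgisserClausenShokrollahi1997, (15.25)] -/
theorem IsApproxRestriction.precomp [Fintype ι] [Fintype κ] [Fintype μ] {h : ℕ} {s : ι → κ → μ → K}
    {t : ι' → κ' → μ' → K} {A : ι' → ι → K[X]} {B : κ' → κ → K[X]} {C : μ' → μ → K[X]}
    (hd : IsApproxRestriction h s t A B C) (f : ι'' → ι') (g : κ'' → κ') (e : μ'' → μ') :
    IsApproxRestriction h s (fun x y z => t (f x) (g y) (e z)) (fun x => A (f x)) (fun y => B (g y))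
      (fun z => C (e z)) :=
  fun x y z j hj => hd (f x) (g y) (e z) j hj

/-- Reindexing the source along bijections keeps a degeneration of order `h`.
[cite: BurgisserClausenShokrollahi1997, (15.25)] -/
theorem IsApproxRestriction.source_equiv [Fintype ι] [Fintype κ] [Fintype μ] [Fintype ι'']
    [Fintype κ''] [Fintype μ''] {h : ℕ} {s : ι → κ → μ → K} {t : ι' → κ' → μ' → K}
    {A : ι' → ι → K[X]} {B : κ' → κ → K[X]} {C : μ' → μ → K[X]}
    (hd : IsApproxRestriction h s t A B C) (e₁ : ι'' ≃ ι) (e₂ : κ'' ≃ κ) (e₃ : μ'' ≃ μ) :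
    IsApproxRestriction h (fun a b c => s (e₁ a) (e₂ b) (e₃ c)) t (fun x a => A x (e₁ a))
      (fun y b => B y (e₂ b)) (fun z c => C z (e₃ c)) := by
  intro x y z j hj
  rw [← hd x y z j hj]
  congr 1
  rw [← e₁.sum_comp]
  refine Finset.sum_congr rfl fun a _ => ?_
  rw [← e₂.sum_comp]
  refine Finset.sum_congr rfl fun b _ => ?_
  rw [← e₃.sum_comp]

end Defs

/-! ## Kronecker products and powers of degenerations -/

section Kronecker

variable {K : Type u} [CommSemiring K]
variable {ι κ μ ι' κ' μ' ι₁ κ₁ μ₁ ι₁' κ₁' μ₁' : Type*}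

/-- **Degenerations multiply** (BCS (15.25): `t ⊴_q t'`, `u ⊴_{q'} u'` imply
`t ⊗ u ⊴_{q+q'} t' ⊗ u'`): the Kronecker products of the matrices give a degeneration of order
`h + h'` from `s ⊗ s₁` to `t ⊗ t₁`. [cite: BurgisserClausenShokrollahi1997, (15.25)] -/
theorem IsApproxRestriction.kronecker [Fintype ι] [Fintype κ] [Fintype μ] [Fintype ι₁] [Fintype κ₁]
    [Fintype μ₁] {h h' : ℕ} {s : ι → κ → μ → K} {t : ι' → κ' → μ' → K} {s₁ : ι₁ → κ₁ → μ₁ → K}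
    {t₁ : ι₁' → κ₁' → μ₁' → K} {A : ι' → ι → K[X]} {B : κ' → κ → K[X]} {C : μ' → μ → K[X]}
    {A₁ : ι₁' → ι₁ → K[X]} {B₁ : κ₁' → κ₁ → K[X]} {C₁ : μ₁' → μ₁ → K[X]}
    (hd : IsApproxRestriction h s t A B C) (hd₁ : IsApproxRestriction h' s₁ t₁ A₁ B₁ C₁) :
    IsApproxRestriction (h + h') (kroneckerTensor s s₁) (kroneckerTensor t t₁)
      (fun x a => A x.1 a.1 * A₁ x.2 a.2) (fun y b => B y.1 b.1 * B₁ y.2 b.2)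
      (fun z c => C z.1 c.1 * C₁ z.2 c.2) := by
  intro x y z j hj
  have hsum : (∑ a : ι × ι₁, ∑ b : κ × κ₁, ∑ c : μ × μ₁, A x.1 a.1 * A₁ x.2 a.2 *
      (B y.1 b.1 * B₁ y.2 b.2) * (C z.1 c.1 * C₁ z.2 c.2) *
        Polynomial.C (kroneckerTensor s s₁ a b c)) =
      (∑ a, ∑ b, ∑ c, A x.1 a * B y.1 b * C z.1 c * Polynomial.C (s a b c)) *
        ∑ a, ∑ b, ∑ c, A₁ x.2 a * B₁ y.2 b * C₁ z.2 c * Polynomial.C (s₁ a b c) := by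
    simp only [Fintype.sum_prod_type, kroneckerTensor_apply, Polynomial.C_mul]
    -- both sides with binders `a a₁ b b₁ c c₁`
    simp only [Finset.sum_mul_sum]
    refine Finset.sum_congr rfl fun a _ => Finset.sum_congr rfl fun a₁ _ =>
      Finset.sum_congr rfl fun b _ => Finset.sum_congr rfl fun b₁ _ =>
      Finset.sum_congr rfl fun c _ => Finset.sum_congr rfl fun c₁ _ => ?_
    ring
  rw [hsum]
  exact coeff_mul_eq_ite_of_coeff_eq_ite (hd x.1 y.1 z.1) (hd₁ x.2 y.2 z.2) j hj

/-- `t ⊴ s`, `t₁ ⊴ s₁` `⟹` `t ⊗ t₁ ⊴ s ⊗ s₁`. [cite: BurgisserClausenShokrollahi1997, (15.25)] -/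
theorem AlgDegeneratesTo.kronecker [Fintype ι] [Fintype κ] [Fintype μ] [Fintype ι₁] [Fintype κ₁]
    [Fintype μ₁] {s : ι → κ → μ → K} {t : ι' → κ' → μ' → K} {s₁ : ι₁ → κ₁ → μ₁ → K}
    {t₁ : ι₁' → κ₁' → μ₁' → K} (hd : AlgDegeneratesTo s t) (hd₁ : AlgDegeneratesTo s₁ t₁) :
    AlgDegeneratesTo (kroneckerTensor s s₁) (kroneckerTensor t t₁) := by
  obtain ⟨h, A, B, C, hd⟩ := hd
  obtain ⟨h', A₁, B₁, C₁, hd₁⟩ := hd₁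
  exact ⟨h + h', _, _, _, hd.kronecker hd₁⟩

/-- **Powers of a degeneration**: `t ⊴_h s` gives `t^{⊗N} ⊴_{Nh} s^{⊗N}` (iterate BCS (15.25)).
[cite: BurgisserClausenShokrollahi1997, (15.25)] -/
theorem IsApproxRestriction.exists_kroneckerPow [Fintype ι] [Fintype κ] [Fintype μ] {h : ℕ}
    {s : ι → κ → μ → K} {t : ι' → κ' → μ' → K} {A : ι' → ι → K[X]} {B : κ' → κ → K[X]}
    {C : μ' → μ → K[X]} (hd : IsApproxRestriction h s t A B C) (N : ℕ) :
    ∃ (AN : (Fin N → ι') → (Fin N → ι) → K[X]) (BN : (Fin N → κ') → (Fin N → κ) → K[X])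
      (CN : (Fin N → μ') → (Fin N → μ) → K[X]),
      IsApproxRestriction (N * h) (kroneckerPow s N) (kroneckerPow t N) AN BN CN := by
  induction N with
  | zero =>
    refine ⟨fun _ _ => 1, fun _ _ => 1, fun _ _ => 1, fun x y z j hj => ?_⟩
    obtain rfl : j = 0 := Nat.le_zero.1 (by simpa using hj)
    simp
  | succ N ih =>
    obtain ⟨AN, BN, CN, hN⟩ := ih
    -- `s^{⊗(N+1)} ≅ s ⊗ s^{⊗N}` on both sides, with matching orders `h + N h = (N+1) h`
    have hk := (hd.kronecker hN).source_equiv (Fin.consEquiv fun _ => ι).symm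
      (Fin.consEquiv fun _ => κ).symm (Fin.consEquiv fun _ => μ).symm
    have hk' := hk.precomp (fun x : Fin (N + 1) → ι' => (x 0, Fin.tail x))
      (fun y : Fin (N + 1) → κ' => (y 0, Fin.tail y)) (fun z : Fin (N + 1) → μ' => (z 0, Fin.tail z))
    have e1 : (fun a b c => kroneckerTensor s (kroneckerPow s N) ((Fin.consEquiv fun _ => ι).symm a)
        ((Fin.consEquiv fun _ => κ).symm b) ((Fin.consEquiv fun _ => μ).symm c)) =
        kroneckerPow s (N + 1) := by
      rw [kroneckerPow_succ_eq]
      rfl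
    have e2 : (fun x y z => kroneckerTensor t (kroneckerPow t N) (x 0, Fin.tail x) (y 0, Fin.tail y)
        (z 0, Fin.tail z)) = kroneckerPow t (N + 1) := (kroneckerPow_succ_eq t N).symm
    have hord : h + N * h = (N + 1) * h := by ring
    rw [e1, e2, hord] at hk'
    exact ⟨_, _, _, hk'⟩

/-- `t ⊴ s ⟹ t^{⊗N} ⊴ s^{⊗N}`. [cite: BurgisserClausenShokrollahi1997, (15.25)] -/
theorem AlgDegeneratesTo.kroneckerPow [Fintype ι] [Fintype κ] [Fintype μ] {s : ι → κ → μ → K}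
    {t : ι' → κ' → μ' → K} (hd : AlgDegeneratesTo s t) (N : ℕ) :
    AlgDegeneratesTo (kroneckerPow s N) (kroneckerPow t N) := by
  obtain ⟨h, A, B, C, hd⟩ := hd
  obtain ⟨AN, BN, CN, hN⟩ := hd.exists_kroneckerPow N
  exact ⟨N * h, AN, BN, CN, hN⟩

end Kronecker

/-! ## The coefficient tensor `M_h` and "degeneration ⟹ restriction of `s ⊗ M_h`" -/

section CoeffTensor

variable (K : Type u) [CommSemiring K]

/-- The **coefficient tensor** `M_h ∈ K^{(h+1)×(h+1)×(h+1)}`, `(M_h)_{ijl} = [i + j + l = h]`: the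
trilinear form extracting the coefficient of `ε^h` from a product of three polynomials truncated at
degree `h` (the tensor behind Bini's bound `R(t) ≤ c_h R_h(t)`, Bläser 2013, Lemma 6.4; BCS (15.26)).
[cite: Blaser2013, Lemma 6.4] -/
def coeffTensor (h : ℕ) : Fin (h + 1) → Fin (h + 1) → Fin (h + 1) → K :=
  fun i j l => if (i : ℕ) + j + l = h then 1 else 0

/-- Entries of `M_h`. [folklore] -/
@[simp] theorem coeffTensor_apply (h : ℕ) (i j l : Fin (h + 1)) :
    coeffTensor K h i j l = if (i : ℕ) + j + l = h then 1 else 0 := rfl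

/-- **`R(M_h) ≤ (h+1)²`**: `M_h = ∑_{i,j} e_i ⊗ e_j ⊗ e_{h-i-j}` (terms with `i + j > h` vanish), at
most `(h+1)²` triads (Bläser 2013, Lemma 6.4: `c_h ≤ C(h+2,2)`; BCS (15.26)). [cite: Blaser2013, Lemma 6.4] -/
theorem tensorRank_coeffTensor_le (h : ℕ) : tensorRank (coeffTensor K h) ≤ (h + 1) ^ 2 := by
  classical
  have hcard : Fintype.card (Fin (h + 1) × Fin (h + 1)) = (h + 1) ^ 2 := by
    simp [Fintype.card_prod, sq]
  rw [← hcard]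
  refine tensorRank_le_card_of_eq_sum (fun p : Fin (h + 1) × Fin (h + 1) => Pi.single p.1 (1 : K))
    (fun p => Pi.single p.2 (1 : K)) (fun p l => if (p.1 : ℕ) + p.2 + l = h then 1 else 0) ?_
  funext i j l
  rw [Finset.sum_apply, Finset.sum_apply, Finset.sum_apply,
    Fintype.sum_eq_single (i, j) (fun p hp => ?_)]
  · simp
  · simp only [triad_apply]
    by_cases hi : p.1 = i
    · have hj : p.2 ≠ j := fun hj => hp (Prod.ext hi hj)
      simp [Pi.single_apply, Ne.symm hj]
    · simp [Pi.single_apply, Ne.symm hi]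

variable {K}
variable {ι κ μ ι' κ' μ' : Type*}

/-- The coefficient of `ε^h` in a product of three polynomials is `M_h` applied to their first
`h+1` coefficients: `(PQR)_h = ∑_{i+j+l=h} P_i Q_j R_l`. [folklore] -/
theorem coeff_mul_mul_eq_sum_coeffTensor (P Q R : K[X]) (h : ℕ) :
    (P * Q * R).coeff h = ∑ i : Fin (h + 1), ∑ j : Fin (h + 1), ∑ l : Fin (h + 1),
      P.coeff i * Q.coeff j * R.coeff l * coeffTensor K h i j l := by
  -- inner identity: for `l ≤ h`, `∑_{i,j} [i+j+l=h] P_i Q_j = (PQ)_{h-l}`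
  have inner : ∀ l : ℕ, l ≤ h → (∑ i : Fin (h + 1), ∑ j : Fin (h + 1),
      (if (i : ℕ) + j + l = h then P.coeff i * Q.coeff j else 0)) = (P * Q).coeff (h - l) := by
    intro l hl
    rw [Polynomial.coeff_mul, Finset.Nat.sum_antidiagonal_eq_sum_range_succ_mk,
      Fin.sum_univ_eq_sum_range (fun i => ∑ j : Fin (h + 1),
        (if i + (j : ℕ) + l = h then P.coeff i * Q.coeff j else 0)) (h + 1)]
    have hsub : Finset.range (h - l + 1) ⊆ Finset.range (h + 1) :=
      Finset.range_subset_range.2 (by omega)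
    rw [← Finset.sum_subset hsub]
    · refine Finset.sum_congr rfl fun i hi => ?_
      rw [Finset.mem_range] at hi
      rw [Fintype.sum_eq_single (⟨h - l - i, by omega⟩ : Fin (h + 1)) (fun j hj => ?_)]
      · dsimp only
        rw [if_pos (by omega)]
      · rw [if_neg]
        intro hsum
        apply hj
        ext
        dsimp only
        omega
    · intro i hi hi'
      rw [Finset.mem_range] at hi hi'
      refine Finset.sum_eq_zero fun j _ => ?_
      rw [if_neg]
      omega
  -- the right-hand side, with `l` outermost
  have hR : (∑ i : Fin (h + 1), ∑ j : Fin (h + 1), ∑ l : Fin (h + 1),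
      P.coeff i * Q.coeff j * R.coeff l * coeffTensor K h i j l) =
      ∑ l : Fin (h + 1), (P * Q).coeff (h - l) * R.coeff l := by
    rw [sum_rev₃]
    refine Finset.sum_congr rfl fun l _ => ?_
    rw [← inner l (Nat.lt_succ_iff.1 l.2), Finset.sum_comm, Finset.sum_mul]
    refine Finset.sum_congr rfl fun i _ => ?_
    rw [Finset.sum_mul]
    refine Finset.sum_congr rfl fun j _ => ?_
    rw [coeffTensor_apply]
    split_ifs <;> ring
  rw [hR, Fin.sum_univ_eq_sum_range (fun l => (P * Q).coeff (h - l) * R.coeff l) (h + 1),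
    Polynomial.coeff_mul, Finset.Nat.sum_antidiagonal_eq_sum_range_succ_mk,
    ← Finset.sum_range_reflect]
  refine Finset.sum_congr rfl fun k hk => ?_
  rw [Finset.mem_range] at hk
  dsimp only
  congr 2
  omega

/-- **A degeneration of order `h` is a restriction of `s ⊗ M_h`**: if `t ⊴_h s` via `A(ε), B(ε), C(ε)`
then `t = (A' ⊗ B' ⊗ C')(s ⊗ M_h)` with `A'_{x,(a,i)} = (A(ε)_{xa})_i` (the coefficient of `ε^i`)
etc. — the restriction behind `R(t) ≤ R(M_h) R_h(t) ≤ (h+1)² R_h(t)` (Bläser 2013, Lemma 6.4;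
BCS (15.26): `t ⊴_q ⟨r⟩ ⟹ R(t) ≤ (q+1)² r`, here for an arbitrary source `s`).
[cite: Blaser2013, Lemma 6.4] -/
theorem IsApproxRestriction.restrictsTo_kronecker_coeffTensor [Fintype ι] [Fintype κ] [Fintype μ]
    {h : ℕ} {s : ι → κ → μ → K} {t : ι' → κ' → μ' → K} {A : ι' → ι → K[X]} {B : κ' → κ → K[X]}
    {C : μ' → μ → K[X]} (hd : IsApproxRestriction h s t A B C) :
    TensorRestrictsTo (kroneckerTensor s (coeffTensor K h)) t := by
  refine ⟨fun x p => (A x p.1).coeff p.2, fun y q => (B y q.1).coeff q.2,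
    fun z o => (C z o.1).coeff o.2, fun x y z => ?_⟩
  have ht := hd x y z h le_rfl
  rw [if_pos rfl] at ht
  rw [← ht]
  simp only [Polynomial.finsetSum_coeff, Polynomial.coeff_mul_C, coeff_mul_mul_eq_sum_coeffTensor,
    Finset.sum_mul, Fintype.sum_prod_type, kroneckerTensor_apply]
  -- LHS binders `a b c i j l`, RHS binders `a i b j c l`
  rw [sum_interleave₃]
  refine Finset.sum_congr rfl fun a _ => Finset.sum_congr rfl fun i _ =>
    Finset.sum_congr rfl fun b _ => Finset.sum_congr rfl fun j _ =>
    Finset.sum_congr rfl fun c _ => Finset.sum_congr rfl fun l _ => ?_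
  ring

/-- **`t ⊴ s ⟹ t ≤ s ⊗ M_h` for some `h`** (BCS (15.26) for an arbitrary source).
[cite: BurgisserClausenShokrollahi1997, (15.26)] -/
theorem AlgDegeneratesTo.exists_restrictsTo_kronecker_coeffTensor [Fintype ι] [Fintype κ] [Fintype μ]
    {s : ι → κ → μ → K} {t : ι' → κ' → μ' → K} (hd : AlgDegeneratesTo s t) :
    ∃ h, TensorRestrictsTo (kroneckerTensor s (coeffTensor K h)) t := by
  obtain ⟨h, A, B, C, hd⟩ := hd
  exact ⟨h, hd.restrictsTo_kronecker_coeffTensor⟩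

end CoeffTensor

/-! ## Universal spectral points are monotone under degeneration -/

section Spectrum

variable {K : Type u} [CommSemiring K]

/-- A universal spectral point takes the value `n` on the unit tensor `⟨n⟩` (additivity and
`F(⟨1⟩) = 1`; CVZ 2023, §1.2 (d); a local copy of the lemma of `RectangularBarrier.lean`, via the
semiring `T(K)`). [cite: ChristandlVranaZuiddam2023, §1.2] -/
private theorem IsUniversalSpectralPoint.map_unitTensor_natCast {F : SpectralMap K}
    (hF : IsUniversalSpectralPoint K F) (n : ℕ) : F (unitTensor K n) = n := by
  rw [← TensorClass.evalRingHom_mk hF, ← TensorClass.natCast_eq_mk, map_natCast]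

/-- `F(t) ≤ R(t)` for a universal spectral point (`t ≤ ⟨R(t)⟩`; CVZ 2023, §1.1: spectral points lie
below the (asymptotic) rank). [cite: ChristandlVranaZuiddam2023, §1.1] -/
theorem IsUniversalSpectralPoint.le_tensorRank {F : SpectralMap K} (hF : IsUniversalSpectralPoint K F)
    {ι κ μ : Type} [Fintype ι] [Fintype κ] [Fintype μ] (t : ι → κ → μ → K) :
    F t ≤ tensorRank t := by
  rw [← hF.map_unitTensor_natCast (tensorRank t)]
  exact hF.mono _ _ (tensorRestrictsTo_unitTensor_of_tensorRank_le t le_rfl)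

/-- `F(t^{⊗N}) = F(t)^N` for a universal spectral point (multiplicativity; `[t]^N = [t^{⊗N}]` in
`T(K)`). [cite: ChristandlVranaZuiddam2023, §1.1] -/
theorem IsUniversalSpectralPoint.map_kroneckerPow {F : SpectralMap K} (hF : IsUniversalSpectralPoint K F)
    {ι κ μ : Type} [Fintype ι] [Fintype κ] [Fintype μ] (t : ι → κ → μ → K) (N : ℕ) :
    F (kroneckerPow t N) = F t ^ N := by
  rw [← TensorClass.evalRingHom_mk hF, ← TensorClass.mk_pow, map_pow, TensorClass.evalRingHom_mk hF]

/-- **Universal spectral points are monotone under degeneration**: `t ⊴ s ⟹ F(t) ≤ F(s)` for every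
universal spectral point `F` (Strassen 1988, §3; CVZ 2023, §1.2: the defining monotonicity may
equivalently be taken with respect to degeneration). Proof: `t^{⊗N} ⊴_{Nh} s^{⊗N} ⟹ t^{⊗N} ≤
s^{⊗N} ⊗ M_{Nh}`, so `F(t)^N ≤ F(s)^N R(M_{Nh}) ≤ (h+1)²(N+1)² F(s)^N` for all `N`, hence
`F(t) ≤ F(s)`. [cite: Strassen1988, §3] -/
theorem IsUniversalSpectralPoint.mono_of_algDegeneratesTo {F : SpectralMap K}
    (hF : IsUniversalSpectralPoint K F) {ι κ μ ι' κ' μ' : Type} [Fintype ι] [Fintype κ] [Fintype μ]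
    [Fintype ι'] [Fintype κ'] [Fintype μ'] {s : ι → κ → μ → K} {t : ι' → κ' → μ' → K}
    (hst : AlgDegeneratesTo s t) : F t ≤ F s := by
  obtain ⟨h, A, B, C, hd⟩ := hst
  refine le_of_forall_pow_le_polynomial_mul_pow (F t) (F s) (((h : ℝ) + 1) ^ 2) 2 (hF.nonneg s)
    fun N => ?_
  obtain ⟨AN, BN, CN, hN⟩ := hd.exists_kroneckerPow N
  have hres := hN.restrictsTo_kronecker_coeffTensor
  have h1 : F (kroneckerPow t N) ≤ F (kroneckerPow s N) * F (coeffTensor K (N * h)) := by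
    rw [← hF.map_kronecker]
    exact hF.mono _ _ hres
  have h2 : F (coeffTensor K (N * h)) ≤ ((N : ℝ) * h + 1) ^ 2 := by
    refine (hF.le_tensorRank _).trans ?_
    exact_mod_cast tensorRank_coeffTensor_le K (N * h)
  have h3 : ((N : ℝ) * h + 1) ^ 2 ≤ ((h : ℝ) + 1) ^ 2 * ((N : ℝ) + 1) ^ 2 := by
    rw [← mul_pow]
    refine pow_le_pow_left₀ (by positivity) ?_ 2
    nlinarith [Nat.cast_nonneg (α := ℝ) N, Nat.cast_nonneg (α := ℝ) h]
  rw [hF.map_kroneckerPow, hF.map_kroneckerPow] at h1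
  have hs0 : 0 ≤ F s ^ N := pow_nonneg (hF.nonneg s) N
  calc F t ^ N ≤ F s ^ N * F (coeffTensor K (N * h)) := h1
    _ ≤ F s ^ N * (((h : ℝ) + 1) ^ 2 * ((N : ℝ) + 1) ^ 2) :=
        mul_le_mul_of_nonneg_left (h2.trans h3) hs0
    _ = ((h : ℝ) + 1) ^ 2 * ((N : ℝ) + 1) ^ 2 * F s ^ N := by ring

/-- **`bR(t) ≤ r ⟹ F(t) ≤ r`** for every universal spectral point `F` (spectral points lie below
the border rank: `t ⊴ ⟨r⟩` and `F(⟨r⟩) = r`; CVZ 2023, §1.1–1.2). [cite: ChristandlVranaZuiddam2023, §1.2] -/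
theorem IsUniversalSpectralPoint.le_of_algBorderRank_le {F : SpectralMap K}
    (hF : IsUniversalSpectralPoint K F) {ι κ μ : Type} [Fintype ι] [Fintype κ] [Fintype μ]
    [DecidableEq ι] [DecidableEq κ] [DecidableEq μ] (t : ι → κ → μ → K) {r : ℕ}
    (hr : algBorderRank t ≤ r) : F t ≤ r := by
  rw [← hF.map_unitTensor_natCast r]
  exact hF.mono_of_algDegeneratesTo (algDegeneratesTo_unitTensor_of_algBorderRank_le t hr)

end Spectrum

end Literature.Computability.AlgebraicComplexity

end
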